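import Literature.NumberTheory.LFunctions.KadiriTestFunction
import Mathlib.Analysis.Complex.AbsMax
import Mathlib.Analysis.Complex.ReImTopology
import HarnessLib

/-!
# Kadiri's positivity of the paired zero terms: `D(σ−β+iy) + D(σ−1+β+iy) ≥ 0` (Acta Arith. 117 (2005), Prop. 2.6 / Prop. 4.2)

Topic `Literature/NumberTheory/LFunctions`. Everything in this file is PROVED (no named fact, no
definition). In Kadiri's treatment of the sum over the zeros (§2.4 and §4.1: "en nous inspirant de
l'idée de Stechkin basée sur la symétrie des zéros de `ζ`"), the zeros `ρ = β + iγ` with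
`1 − σ ≤ β ≤ σ` are discarded thanks to the positivity

  `D(σ − β + iy) + D(σ − 1 + β + iy) ≥ 0`,  `D(x + iy) = F̃(x, y) − κ F̃(x + δ, y)`,  `F̃ = Re F`,

(Prop. 2.6 = Prop. 4.2, generalising Stechkin's Lemma). Kadiri's proof applies "le principe du
maximum à `Q`", the quotient of the two pair sums; as noted in the tree's notes the quotient of two
harmonic functions is not harmonic, and we run the argument instead with the DIFFERENCE
`u − κv = Re Ψ(z)`, `Ψ(z) = [F(σ−z) + F(σ−1+z)] − κ[F(σ+δ−z) + F(σ+δ−1+z)]`, which is the real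
part of an entire function: by the symmetry `Ψ(1 − z) = Ψ(z)` of the strip `1−σ ≤ Re z ≤ σ`, the
evenness `F̃(x, −y) = F̃(x, y)`, the decay `F̃(x, y) → 0` (`|y| → ∞`, Lemma 3.2) and the maximum
modulus principle for `e^{−Ψ}` on the rectangles `[1−σ, σ] × [−Y, Y]`, the inequality
`Re Ψ ≥ 0` on the whole strip follows from its validity on the single line `Re z = σ`, where it
reads `F̃(0,y) + F̃(2σ−1,y) ≥ κ[F̃(δ,y) + F̃(2σ−1+δ,y)]` — exactly the inequality `Q(σ+iy) ≥ κ`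
that Kadiri verifies from (H₂) and Lemma 3.2 (her `Q₂(y)`, `κ₂(δ)`, `κ₃(δ)`; done per round with
the round's constants, not here).

* `Literature.NumberTheory.LFunctions.KadiriPair.re_nonneg_of_strip` — the strip minimum principle
  for the real part of an entire function;
* `Literature.NumberTheory.LFunctions.KadiriPair.fordLaplace_conj`, `re_fordLaplace_neg_im` —
  `F(z̄) = conj F(z)`, `F̃(x, −y) = F̃(x, y)`;
* `Literature.NumberTheory.LFunctions.KadiriPair.pair_nonneg` — Prop. 4.2 for any continuous
  compactly supported `f`, GIVEN the boundary inequality on `Re z = σ` and the decay of `F̃`;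
* `Literature.NumberTheory.LFunctions.KadiriPair.decay_kadiriTest` — the decay hypothesis for
  Kadiri's test function `f = ηh(η·)` (from Lemma 3.2, `KadiriTest.abs_re_fordLaplace_sub_le`).

## References

* H. Kadiri, *Une région explicite sans zéros pour la fonction ζ de Riemann*, Acta Arith. 117
  (2005) = arXiv:math/0401238, Prop. 2.6, §4.1.2, Lemma 4.1 (Stechkin), Prop. 4.2 and its proof.
  (`Kadiri2005`)
* S. B. Stechkin, *The zeros of the Riemann zeta-function*, Math. Notes 8 (1970), Lemma 2
  (as cited by Kadiri, [Stechkin1]).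
-/

noncomputable section

open Complex Real MeasureTheory Set Filter Topology Metric
open scoped ComplexConjugate

namespace Literature.NumberTheory.LFunctions

namespace KadiriPair

/-! ## The strip minimum principle for `Re Ψ` -/

/-- **Minimum principle on a vertical strip.** Let `Ψ` be entire, `a < b`. If `Re Ψ ≥ 0` on the
two lines `Re z = a`, `Re z = b`, and `Re Ψ(x+iy) ≥ −ε` for `a ≤ x ≤ b`, `|y| ≥ Y₀(ε)` (every
`ε > 0`), then `Re Ψ ≥ 0` on the closed strip `a ≤ Re z ≤ b` (maximum modulus for `e^{−Ψ}` on the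
rectangles `[a,b] × [−Y,Y]`). [folklore] -/
theorem re_nonneg_of_strip {Ψ : ℂ → ℂ} (hΨ : Differentiable ℂ Ψ) {a b : ℝ} (hab : a < b)
    (hbdry : ∀ y : ℝ, 0 ≤ (Ψ ((a : ℂ) + y * I)).re ∧ 0 ≤ (Ψ ((b : ℂ) + y * I)).re)
    (hdecay : ∀ ε : ℝ, 0 < ε → ∃ Y₀ : ℝ, 0 < Y₀ ∧ ∀ x : ℝ, x ∈ Icc a b → ∀ y : ℝ, Y₀ ≤ |y| →
      -ε ≤ (Ψ ((x : ℂ) + y * I)).re)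
    {z : ℂ} (hz : z.re ∈ Icc a b) : 0 ≤ (Ψ z).re := by
  refine le_of_forall_pos_lt_add fun ε hε ↦ ?_
  obtain ⟨Y₀, hY₀, hY⟩ := hdecay (ε / 2) (by positivity)
  set Y : ℝ := max Y₀ (|z.im| + 1) with hYdef
  have hYY₀ : Y₀ ≤ Y := le_max_left _ _
  have hYz : |z.im| < Y := by have := le_max_right Y₀ (|z.im| + 1); linarith
  have hY0 : 0 < Y := hY₀.trans_le hYY₀
  set U : Set ℂ := Ioo a b ×ℂ Ioo (-Y) Y with hU
  have hUbdd : Bornology.IsBounded U := (Metric.isBounded_Ioo a b).reProdIm (Metric.isBounded_Ioo _ _)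
  have hd : DiffContOnCl ℂ (fun w ↦ Complex.exp (-Ψ w)) U := (hΨ.neg.cexp).diffContOnCl
  have hfront : ∀ w ∈ frontier U, ‖Complex.exp (-Ψ w)‖ ≤ Real.exp (ε / 2) := by
    intro w hw
    rw [hU, frontier_reProdIm, closure_Ioo hab.ne, closure_Ioo (by linarith : (-Y) ≠ Y),
      frontier_Ioo hab, frontier_Ioo (by linarith : (-Y) < Y)] at hw
    have hw_eq : w = ((w.re : ℂ) + w.im * I) := (Complex.re_add_im w).symm
    have hre : -(ε / 2) ≤ (Ψ w).re := by
      rcases hw with ⟨hwre, hwim⟩ | ⟨hwre, hwim⟩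
      · -- horizontal sides: `|Im w| = Y ≥ Y₀`
        have habs : Y₀ ≤ |w.im| := by
          rcases hwim with h | h <;> rw [h] <;> simp [abs_of_pos hY0, hYY₀]
        have := hY w.re hwre w.im habs
        rwa [← hw_eq] at this
      · -- vertical sides
        rcases hwre with h | h
        · have := (hbdry w.im).1
          rw [← h, ← hw_eq] at this
          linarith
        · have := (hbdry w.im).2
          rw [← h, ← hw_eq] at this
          linarith
    rw [Complex.norm_exp, Real.exp_le_exp, Complex.neg_re]
    linarith
  have hzU : z ∈ closure U := by
    rw [hU, closure_reProdIm, closure_Ioo hab.ne, closure_Ioo (by linarith : (-Y) ≠ Y)]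
    exact ⟨hz, abs_le.1 hYz.le⟩
  have key := Complex.norm_le_of_forall_mem_frontier_norm_le hUbdd hd hfront hzU
  rw [Complex.norm_exp, Real.exp_le_exp, Complex.neg_re] at key
  linarith

/-! ## `F(z̄) = conj F(z)`: `F̃` is even in `y` -/

/-- The Laplace transform of a real function commutes with conjugation. [folklore] -/
theorem fordLaplace_conj (f : ℝ → ℝ) (z : ℂ) : fordLaplace f (conj z) = conj (fordLaplace f z) := by
  unfold fordLaplace
  rw [← integral_conj]
  refine setIntegral_congr_fun measurableSet_Ioi fun u _ ↦ ?_
  rw [map_mul, Complex.conj_ofReal, ← Complex.exp_conj, map_neg, map_mul, Complex.conj_ofReal]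

/-- `F̃(x, −y) = F̃(x, y)`. [folklore] -/
theorem re_fordLaplace_neg_im (f : ℝ → ℝ) (x y : ℝ) :
    (fordLaplace f ((x : ℂ) - y * I)).re = (fordLaplace f ((x : ℂ) + y * I)).re := by
  have : ((x : ℂ) - y * I) = conj ((x : ℂ) + y * I) := by
    apply Complex.ext <;> simp
  rw [this, fordLaplace_conj, Complex.conj_re]

/-! ## The pair positivity -/

/-- **Kadiri's Prop. 2.6 / Prop. 4.2 (pair positivity), from the boundary inequality.** Let `f` be
continuous, vanishing on `[x₀, ∞)` (`x₀ ≥ 0`), `F` its Laplace transform, `F̃ = Re F`; let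
`σ > 1/2`, `δ ≥ 0`, `κ ≥ 0`. Suppose (decay) `F̃(x, y) → 0` as `|y| → ∞` uniformly for
`0 ≤ x ≤ 2σ−1+δ`, and (boundary) `F̃(0,y) + F̃(2σ−1,y) ≥ κ[F̃(δ,y) + F̃(2σ−1+δ,y)]` for all `y`.
Then for every `β ∈ [1−σ, σ]` and every `y`,
`[F̃(σ−β,y) + F̃(σ−1+β,y)] − κ[F̃(σ+δ−β,y) + F̃(σ+δ−1+β,y)] ≥ 0`, i.e.
`D(σ−β+iy) + D(σ−1+β+iy) ≥ 0`. [cite: Kadiri2005, Prop. 4.2] -/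
theorem pair_nonneg {f : ℝ → ℝ} {x₀ : ℝ} (hfc : Continuous f) (hx₀ : 0 ≤ x₀)
    (hf0 : ∀ u, x₀ ≤ u → f u = 0) {σ δ κ : ℝ} (hσ : 1 / 2 < σ) (hδ : 0 ≤ δ) (hκ : 0 ≤ κ)
    (hdec : ∀ ε : ℝ, 0 < ε → ∃ Y₀ : ℝ, 0 < Y₀ ∧ ∀ x : ℝ, x ∈ Icc 0 (2 * σ - 1 + δ) → ∀ y : ℝ,
      Y₀ ≤ |y| → |(fordLaplace f ((x : ℂ) + y * I)).re| ≤ ε)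
    (hB : ∀ y : ℝ, κ * ((fordLaplace f ((δ : ℂ) + y * I)).re +
        (fordLaplace f (((2 * σ - 1 + δ : ℝ) : ℂ) + y * I)).re) ≤
      (fordLaplace f (((0 : ℝ) : ℂ) + y * I)).re + (fordLaplace f (((2 * σ - 1 : ℝ) : ℂ) + y * I)).re)
    {β : ℝ} (hβ : β ∈ Icc (1 - σ) σ) (y : ℝ) :
    0 ≤ ((fordLaplace f (((σ - β : ℝ) : ℂ) + y * I)).re +
          (fordLaplace f (((σ - 1 + β : ℝ) : ℂ) + y * I)).re) -
        κ * ((fordLaplace f (((σ + δ - β : ℝ) : ℂ) + y * I)).re +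
          (fordLaplace f (((σ + δ - 1 + β : ℝ) : ℂ) + y * I)).re) := by
  set F : ℂ → ℂ := fordLaplace f with hF
  have hFd : Differentiable ℂ F := differentiable_fordLaplace hfc hx₀ hf0
  set Ψ : ℂ → ℂ := fun z ↦ (F (σ - z) + F (σ - 1 + z)) - κ * (F (σ + δ - z) + F (σ + δ - 1 + z))
    with hΨ
  have hΨd : Differentiable ℂ Ψ := by
    rw [hΨ]
    refine ((hFd.comp ((differentiable_const _).sub differentiable_id)).add
      (hFd.comp ((differentiable_const _).add differentiable_id))).sub
      ((differentiable_const _).mul ((hFd.comp ((differentiable_const _).sub differentiable_id)).add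
        (hFd.comp ((differentiable_const _).add differentiable_id))))
  -- the real part of `Ψ` at `x + iy`
  have hre : ∀ x y : ℝ, (Ψ ((x : ℂ) + y * I)).re =
      ((F (((σ - x : ℝ) : ℂ) + y * I)).re + (F (((σ - 1 + x : ℝ) : ℂ) + y * I)).re) -
        κ * ((F (((σ + δ - x : ℝ) : ℂ) + y * I)).re + (F (((σ + δ - 1 + x : ℝ) : ℂ) + y * I)).re) := by
    intro x y
    have e1 : (σ : ℂ) - ((x : ℂ) + y * I) = ((σ - x : ℝ) : ℂ) - y * I := by push_cast; ring
    have e2 : (σ : ℂ) - 1 + ((x : ℂ) + y * I) = ((σ - 1 + x : ℝ) : ℂ) + y * I := by push_cast; ring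
    have e3 : (σ : ℂ) + δ - ((x : ℂ) + y * I) = ((σ + δ - x : ℝ) : ℂ) - y * I := by push_cast; ring
    have e4 : (σ : ℂ) + δ - 1 + ((x : ℂ) + y * I) = ((σ + δ - 1 + x : ℝ) : ℂ) + y * I := by
      push_cast; ring
    simp only [hΨ, e1, e2, e3, e4, Complex.sub_re, Complex.add_re, Complex.mul_re, Complex.ofReal_re,
      Complex.ofReal_im, zero_mul, sub_zero, hF, re_fordLaplace_neg_im]
  have hab : 1 - σ < σ := by linarith
  have key := re_nonneg_of_strip hΨd hab ?_ ?_ (z := (β : ℂ) + y * I) (by simpa using hβ)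
  · rwa [hre] at key
  · -- the two boundary lines reduce to `hB`
    intro y'
    have h1 := hB y'
    constructor
    · rw [show (((1 - σ : ℝ)) : ℂ) = ((1 - σ : ℝ) : ℂ) from rfl, hre]
      have ea : (σ - (1 - σ) : ℝ) = 2 * σ - 1 := by ring
      have eb : (σ - 1 + (1 - σ) : ℝ) = 0 := by ring
      have ec : (σ + δ - (1 - σ) : ℝ) = 2 * σ - 1 + δ := by ring
      have ed : (σ + δ - 1 + (1 - σ) : ℝ) = δ := by ring
      rw [ea, eb, ec, ed]
      have : (((δ : ℝ)) : ℂ) = (δ : ℂ) := rfl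
      linarith
    · rw [hre]
      have ea : (σ - σ : ℝ) = 0 := by ring
      have eb : (σ - 1 + σ : ℝ) = 2 * σ - 1 := by ring
      have ec : (σ + δ - σ : ℝ) = δ := by ring
      have ed : (σ + δ - 1 + σ : ℝ) = 2 * σ - 1 + δ := by ring
      rw [ea, eb, ec, ed]
      linarith
  · -- decay
    intro ε hε
    obtain ⟨Y₀, hY₀, hY⟩ := hdec (ε / (2 * (1 + κ))) (by positivity)
    refine ⟨Y₀, hY₀, fun x hx y' hy' ↦ ?_⟩
    rw [hre]
    have hx1 : σ - x ∈ Icc 0 (2 * σ - 1 + δ) := ⟨by linarith [hx.2], by linarith [hx.1]⟩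
    have hx2 : σ - 1 + x ∈ Icc 0 (2 * σ - 1 + δ) := ⟨by linarith [hx.1], by linarith [hx.2]⟩
    have hx3 : σ + δ - x ∈ Icc 0 (2 * σ - 1 + δ) := ⟨by linarith [hx.2], by linarith [hx.1]⟩
    have hx4 : σ + δ - 1 + x ∈ Icc 0 (2 * σ - 1 + δ) := ⟨by linarith [hx.1], by linarith [hx.2]⟩
    have b1 := abs_le.1 (hY _ hx1 y' hy')
    have b2 := abs_le.1 (hY _ hx2 y' hy')
    have b3 := abs_le.1 (hY _ hx3 y' hy')
    have b4 := abs_le.1 (hY _ hx4 y' hy')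
    have hk : κ * ((F (((σ + δ - x : ℝ) : ℂ) + y' * I)).re + (F (((σ + δ - 1 + x : ℝ) : ℂ) + y' * I)).re)
        ≤ κ * (2 * (ε / (2 * (1 + κ)))) := mul_le_mul_of_nonneg_left (by linarith [b3.2, b4.2]) hκ
    have htot : -(2 * (ε / (2 * (1 + κ)))) - κ * (2 * (ε / (2 * (1 + κ)))) = -ε := by
      field_simp
      ring
    linarith [b1.1, b2.1]

/-! ## The decay hypothesis for Kadiri's test function -/

/-- **Decay of `F̃` for `f = ηh(η·)`** (Lemma 3.2: `|F̃(x,y)| ≤ ηg₁|x|/(x²+y²) + M(x/η)η²/(x²+y²)`,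
`M(x/η) ≤ M(0)` for `x ≥ 0`): `F̃(x, y) → 0` as `|y| → ∞`, uniformly for `0 ≤ x ≤ X`.
[cite: Kadiri2005, Lemma 3.2] -/
theorem decay_kadiriTest {θ η : ℝ} (hθ : 0 < θ) (hθ' : θ < π / 2) (hη : 0 < η) {X : ℝ} (hX : 0 ≤ X)
    (ε : ℝ) (hε : 0 < ε) :
    ∃ Y₀ : ℝ, 0 < Y₀ ∧ ∀ x : ℝ, x ∈ Icc 0 X → ∀ y : ℝ, Y₀ ≤ |y| →
      |(fordLaplace (kadiriTest θ η) ((x : ℂ) + y * I)).re| ≤ ε := by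
  set C : ℝ := η * fordSmoothW0 θ * X + mtyM θ 0 * η ^ 2 with hC
  have hg : 0 < fordSmoothW0 θ := fordSmoothW0_pos hθ hθ'
  have hM0 : 0 ≤ mtyM θ 0 := KadiriTest.mtyM_nonneg hθ hθ' 0
  have hC0 : 0 ≤ C := by positivity
  refine ⟨Real.sqrt (C / ε) + 1, by positivity, fun x hx y hy ↦ ?_⟩
  set z : ℂ := (x : ℂ) + y * I with hz
  have hy0 : 0 < |y| := by have := Real.sqrt_nonneg (C / ε); linarith
  have hzre : z.re = x := by simp [hz]
  have hzim : z.im = y := by simp [hz]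
  have hz0 : z ≠ 0 := fun h ↦ by
    have := congrArg Complex.im h; rw [hzim] at this; simp at this; rw [this, abs_zero] at hy0
    exact lt_irrefl _ hy0
  have hnorm : y ^ 2 ≤ ‖z‖ ^ 2 := by
    have := Complex.abs_im_le_norm z
    rw [hzim] at this
    nlinarith [abs_nonneg y, sq_abs y]
  have hn0 : 0 < ‖z‖ ^ 2 := by positivity
  have hL := KadiriTest.abs_re_fordLaplace_sub_le hθ hθ' hη hz0
  rw [hzre] at hL
  have hM : mtyM θ (x / η) ≤ mtyM θ 0 := KadiriTest.mtyM_antitone hθ hθ' (div_nonneg hx.1 hη.le)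
  -- `|F̃| ≤ (ηg₁ x + M(0)η²)/‖z‖² ≤ C/y² ≤ ε`
  set a : ℝ := (fordLaplace (kadiriTest θ η) z).re with ha
  set b : ℝ := η * fordSmoothW0 θ * x / ‖z‖ ^ 2 with hb
  have hb0 : 0 ≤ b := by have := hx.1; positivity
  have htri : |a| ≤ |a - b| + |b| := by
    calc |a| = |(a - b) + b| := by ring_nf
      _ ≤ |a - b| + |b| := abs_add_le _ _
  have h1 : |a - b| ≤ mtyM θ 0 * η ^ 2 / ‖z‖ ^ 2 := by
    refine hL.trans ?_
    gcongr
  have h2 : |b| ≤ η * fordSmoothW0 θ * X / ‖z‖ ^ 2 := by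
    rw [abs_of_nonneg hb0, hb]
    gcongr
    exact hx.2
  have h3 : |a| ≤ C / ‖z‖ ^ 2 := by
    have : mtyM θ 0 * η ^ 2 / ‖z‖ ^ 2 + η * fordSmoothW0 θ * X / ‖z‖ ^ 2 = C / ‖z‖ ^ 2 := by
      rw [hC]; ring
    linarith
  have hy2 : C / ε ≤ y ^ 2 := by
    have hs : Real.sqrt (C / ε) ≤ |y| := by linarith
    have := pow_le_pow_left₀ (Real.sqrt_nonneg _) hs 2
    rwa [Real.sq_sqrt (by positivity), sq_abs] at this
  have hy20 : 0 < y ^ 2 := by rw [← sq_abs]; exact pow_pos hy0 2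
  have h4 : C / ‖z‖ ^ 2 ≤ C / y ^ 2 := div_le_div_of_nonneg_left hC0 hy20 hnorm
  have h5 : C / y ^ 2 ≤ ε := by
    rw [div_le_iff₀ hy20]
    have := (div_le_iff₀ hε).1 hy2
    linarith
  linarith

end KadiriPair

end Literature.NumberTheory.LFunctions
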